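import Summits.QuantumFields.YangMills.Theorems.UnitScaleTiltProp7FibreELOfCritSplit
import Summits.QuantumFields.YangMills.Theorems.UnitScaleTiltProp7GaugeSliceDecompositionSplit
import HarnessLib

/-!
# Route `UnitScaleTilt`, crux K1 child «MinimiserStabilityRegPr» (stmt-QuantumFields-19200), stub `stub_existenceMinimalOrbit` (EX) — **INHABITABILITY CERTIFICATE FOR THE DISPLAYED ROW
# `hSplit127` OF THE (123)–(127) DOOR (✓`Prop7Crit127OfCrit93Split.hCrit127_of_hCrit93_of_split127`) AT THE BASE POINT `A′ = 0`** (★★OWNER RULING g27-№9 (3): every displayed row carries an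
# inhabitability check — here kernel-checked at `A′ = 0` from `RegPr U₀` alone).

Cell `ym3-torus`, width seat `ym3-torus-px21` (gen 0).  THEOREMS ONLY (0 `def`, 0 `sorry`).  `--supports stmt-QuantumFields-19200 --as helper`, count-neutral.  YM₃ on T³ is a ladder
rung (R3), not the Clay problem; nothing here claims the stub, the crux, d = 4 or the mass gap.  No display is changed.

THE POINT.  The door's hypothesis `hSplit127` quantifies over every Fréchet derivative `D` of the (47)-map `χ(A″) = A″ − H·Dfix(CmapTwS U₀) H C₂ˢ A″` at the chart coordinate `A′` and asks that
the `U′`-velocity `g(ad(−χ(A′)))(Dδ)` of every real `δ ∈ ker Q` split as the velocity of a SLICE direction plus an infinitesimal gauge direction.  At `A′ = 0`: `Dfix(0) = 0` ((55): «a power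
series expansion of D(A′) begins with second order terms», ✓`B11Ineq190FromProp3.Dfix_zero`) and `|Dfix(A″)| ≤ 4C₂|A″|²` (✓`B11Prop3Model.Dfix_spec`) so `Dfix` has ZERO Fréchet derivative at `0`
(§1), hence `χ` has derivative the IDENTITY at `0` (§2), `χ(0) = 0`, `U′ = U₀`, `g(ad 0) = 1` — and the row IS ✓`Prop7GaugeSliceDecomposition.exists_slice_add_gaugeDir_hsplit_at_regPr`
([Balaban1985RegularSpaces] Sect. D linearised at `U₀`), i.e. inhabited from `RegPr U₀` alone (§3).  At `A′ ≠ 0` the supplier is the (P2) row of the transport lineage (not here).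

WHAT IS PROVED (sorry-free, no definition; ns `…Theorems.Prop7Crit127Split127AtZero`).
§1 ★ `hasFDerivAt_Dfix_zero` — generic ([Balaban1985Variational] Prop. 3 inputs + the printed smallness `18C₂B₀ε₃ ≤ 1`, `2ε₃ ≤ c₄`): `HasFDerivAt (Dfix C H C₂) 0 0` (from `Dfix 0 = 0` and the
   quadratic bound (55), little-o bookkeeping).
§2 ★ `hasFDerivAt_chartTwS_zero` — at the member, `χ` has Fréchet derivative `ContinuousLinearMap.id` at `0`; `chartTwS_zero` — `χ(0) = 0`.
§3 ★★ `split127_at_zero` — the door's `hSplit127` with `A′ := 0`, `X := 0`, `Ker δ := (QTwS U₀ δ = 0)`, `Sl := IsLandauPrintS c₀ cB U₀`, VERBATIM, from `RegPr U₀` and the chart windows.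
HONEST SCOPE: a consistency∕inhabitability check of a displayed row at one point; it supplies nothing at the knit's `A′ ≠ 0`.

References: T. Bałaban, CMP 102 (1985) 277–309 [Balaban1985Variational] ((47)–(55) pp.285–286, Prop. 3 p.289, (123)–(127) pp.296–297); CMP 99 (1985) 75–102 [Balaban1985RegularSpaces]
(Sect. D pp.89–95); CMP 98 (1985) 17–51 [Balaban1985Averaging] ((29), (33) p.22).
-/

set_option autoImplicit false

noncomputable section

open scoped BigOperators Matrix.Norms.L2Operator Matrix Topology
open Filter Asymptotics

namespace Summit.QuantumFields.YangMills.Theorems.Prop7Crit127Split127AtZero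

open NormedSpace
open Literature.Analysis.Calculus.ExpDifferential (ad gSer gSer_zero)
open Literature.MathematicalPhysics.QuantumFieldTheory.Balaban1983to89
open Literature.MathematicalPhysics.QuantumFieldTheory.Balaban1983to89.T3ContinuumYM3Torus
open Literature.MathematicalPhysics.QuantumFieldTheory.Balaban1983to89.T3PrintedRegularMinimiser (RegPr)
open Literature.MathematicalPhysics.QuantumFieldTheory.Balaban1983to89.T3SectALandauChart (emb15 eta eta_pos)
open B11Prop3Model (Dfix Inputs Dfix_spec)
open B11Ineq190FromProp3 (Dfix_zero)
open Summit.QuantumFields.YangMills.Theorems.Prop7TPrint (expHermField expHermField_zero)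
open Summit.QuantumFields.YangMills.Theorems.Prop7SPrint (IsLandauPrintS)
open Summit.QuantumFields.YangMills.Theorems.Prop7SymAvgTwSym (QTwS CmapTwS)
open Summit.QuantumFields.YangMills.Theorems.Prop7CmapTwSymInputs (inputs_CmapTwS)
open Summit.QuantumFields.YangMills.Theorems.Prop7GaugeSliceDecomposition (exists_slice_add_gaugeDir_hsplit_at_regPr)

/-! ## §1 `Dfix` has zero derivative at the origin (generic) -/

section Generic

variable {𝒳 𝒴 : Type*} [NormedAddCommGroup 𝒳] [NormedSpace ℂ 𝒳] [NormedAddCommGroup 𝒴] [NormedSpace ℂ 𝒴]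
  [CompleteSpace 𝒳] {C : 𝒴 → 𝒳} {H : 𝒳 →L[ℂ] 𝒴} {C₂ C₃ B₀ c₄ ε₃ : ℝ}

/-- ★ **`(δ∕δA′)D(0) = 0`** — the selector `D = Dfix` of (49) vanishes at `0` and is quadratically small, `|D(A′)| ≤ 4C₂|A′|²` (55) («a power series expansion of D(A′) begins with second
order terms», p. 286), so its Fréchet derivative at `0` is `0`. [cite: Balaban1985Variational, (55) p.286, (49)–(52) p.285, Prop. 3 p.289] -/
theorem hasFDerivAt_Dfix_zero (hin : Inputs C (H : 𝒳 →ₗ[ℂ] 𝒴) C₂ C₃ B₀ c₄) (hC₂ : 0 ≤ C₂) (hB₀ : 0 ≤ B₀) (hε₃ : 0 < ε₃)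
    (h18 : 18 * C₂ * B₀ * ε₃ ≤ 1) (h2 : 2 * ε₃ ≤ c₄) :
    HasFDerivAt (Dfix C (H : 𝒳 →ₗ[ℂ] 𝒴) C₂) (0 : 𝒴 →L[ℂ] 𝒳) 0 := by
  have hD0 : Dfix C (H : 𝒳 →ₗ[ℂ] 𝒴) C₂ 0 = 0 := Dfix_zero hin hC₂ hB₀ hε₃ h18 h2
  -- the quadratic bound (55) on the ball `‖A‖ < ε₃`
  have hc₄ : 0 < c₄ := by linarith
  have hq : 9 * C₂ * B₀ * ε₃ < 1 := by nlinarith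
  have hRC : 3 * ε₃ ≤ 2 * c₄ := by linarith
  have hquad : ∀ A : 𝒴, ‖A‖ < ε₃ → ‖Dfix C (H : 𝒳 →ₗ[ℂ] 𝒴) C₂ A‖ ≤ 4 * C₂ * ‖A‖ ^ 2 := fun A hA =>
    (Dfix_spec hin.quadAnalytic hC₂ hB₀ hin.norm_H hq hRC hA).1
  rw [hasFDerivAt_iff_isLittleO_nhds_zero]
  refine IsLittleO.of_bound fun c hc => ?_
  -- on the ball `‖h‖ < min ε₃ (c ∕ (4C₂ + 1))` the bound `4C₂‖h‖² ≤ c‖h‖` holds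
  have hr : 0 < min ε₃ (c / (4 * C₂ + 1)) := lt_min hε₃ (div_pos hc (by linarith))
  filter_upwards [Metric.ball_mem_nhds (0 : 𝒴) hr] with k hk
  rw [Metric.mem_ball, dist_zero_right] at hk
  have hkε : ‖k‖ < ε₃ := lt_of_lt_of_le hk (min_le_left _ _)
  have hkc : ‖k‖ < c / (4 * C₂ + 1) := lt_of_lt_of_le hk (min_le_right _ _)
  rw [zero_add, hD0, sub_zero, show ((0 : 𝒴 →L[ℂ] 𝒳) k) = 0 from rfl, sub_zero]
  have h1 := hquad k hkε
  have hkc' : (4 * C₂ + 1) * ‖k‖ ≤ c := by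
    have := (lt_div_iff₀ (by linarith : (0 : ℝ) < 4 * C₂ + 1)).1 hkc
    linarith
  calc ‖Dfix C (H : 𝒳 →ₗ[ℂ] 𝒴) C₂ k‖ ≤ 4 * C₂ * ‖k‖ ^ 2 := h1
    _ ≤ (4 * C₂ + 1) * ‖k‖ * ‖k‖ := by nlinarith [norm_nonneg k]
    _ ≤ c * ‖k‖ := by exact mul_le_mul_of_nonneg_right hkc' (norm_nonneg k)

end Generic

/-! ## §2 The (47)-map at the member: `χ(0) = 0`, `Dχ(0) = id` -/

section Member

variable (F : T3Family) {n K : ℕ} (h : n ≤ K) [Fact (0 < (F.L : ℝ))] [Fact (0 < ((F.L : ℝ)⁻¹) ^ (K - n))]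

omit [Fact (0 < ((F.L : ℝ)⁻¹) ^ (K - n))] in
/-- ★ **`Dχ(0) = id`**: at `U₀ ∈ 𝔘_k(ε₀)` with (WF), for the (46) letter `H` (bound `b ≥ 0`) in the contraction window `9C₂ˢbε < 1`, `6ε ≤ e·η`, `0 < ε`, the (47)-map
`χ(A″) = A″ − H·Dfix(CmapTwS U₀) H C₂ˢ A″` has Fréchet derivative `ContinuousLinearMap.id` at `0` (§1 at `ε₃ := ε∕2` with ✓`inputs_CmapTwS`). [cite: Balaban1985Variational, (47)–(49) p.285, (55) p.286, Prop. 3 p.289] -/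
theorem hasFDerivAt_chartTwS_zero {ε₀ e b ε : ℝ} (hε₀ : 0 < ε₀) (he : 0 < e) (hWe : 10 ^ 9 * (F.L : ℝ) ^ 2 * e ≤ 1) (hWε : 10 ^ 12 * (F.L : ℝ) ^ 3 * ε₀ ≤ 1)
    (U₀ : GaugeField (F.P K) 0 (Matrix.specialUnitaryGroup (Fin 2) ℂ)) (hreg : RegPr F n K ε₀ U₀)
    {H : (PBond (F.P n) 0 → Matrix (Fin 2) (Fin 2) ℂ) →ₗ[ℂ] (PBond (F.P K) 0 → Matrix (Fin 2) (Fin 2) ℂ)} (hb : 0 ≤ b) (hHop : ∀ Y, ‖H Y‖ ≤ b * ‖Y‖)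
    (hε : 0 < ε) (hq : 9 * (40 * (2 * (3 * (2 * e + 2700 * (F.L : ℝ) * ε₀))) / (e * eta F n K) ^ 2) * b * ε < 1) (hRε : 6 * ε ≤ e * eta F n K) :
    HasFDerivAt (fun A : PBond (F.P K) 0 → Matrix (Fin 2) (Fin 2) ℂ => A - H (Dfix (CmapTwS F n K h U₀) H (40 * (2 * (3 * (2 * e + 2700 * (F.L : ℝ) * ε₀))) / (e * eta F n K) ^ 2) A))
      (ContinuousLinearMap.id ℂ (PBond (F.P K) 0 → Matrix (Fin 2) (Fin 2) ℂ)) 0 := by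
  haveI : CompleteSpace (PBond (F.P n) 0 → Matrix (Fin 2) (Fin 2) ℂ) := FiniteDimensional.complete ℂ _
  haveI : CompleteSpace (PBond (F.P K) 0 → Matrix (Fin 2) (Fin 2) ℂ) := FiniteDimensional.complete ℂ _
  set C₂ : ℝ := 40 * (2 * (3 * (2 * e + 2700 * (F.L : ℝ) * ε₀))) / (e * eta F n K) ^ 2 with hC₂def
  have hη : 0 < eta F n K := eta_pos F n K
  have hC₂ : 0 ≤ C₂ := by
    have hL : (0 : ℝ) < (F.L : ℝ) := Fact.out
    positivity
  set Hc : (PBond (F.P n) 0 → Matrix (Fin 2) (Fin 2) ℂ) →L[ℂ] (PBond (F.P K) 0 → Matrix (Fin 2) (Fin 2) ℂ) := LinearMap.toContinuousLinearMap H with hHc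
  have hHcH : (Hc : (PBond (F.P n) 0 → Matrix (Fin 2) (Fin 2) ℂ) →ₗ[ℂ] (PBond (F.P K) 0 → Matrix (Fin 2) (Fin 2) ℂ)) = H := LinearMap.coe_toContinuousLinearMap H
  have hin : B11Prop3Model.Inputs (CmapTwS F n K h U₀) (Hc : (PBond (F.P n) 0 → Matrix (Fin 2) (Fin 2) ℂ) →ₗ[ℂ] (PBond (F.P K) 0 → Matrix (Fin 2) (Fin 2) ℂ))
      C₂ C₂ b ((e * eta F n K) / 4) := by
    rw [hHcH]; exact inputs_CmapTwS F h hε₀ he hWe hWε U₀ hreg hHop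
  have hε₃ : 0 < ε / 2 := by linarith
  have h18 : 18 * C₂ * b * (ε / 2) ≤ 1 := by
    have : 18 * C₂ * b * (ε / 2) = 9 * C₂ * b * ε := by ring
    rw [this]; exact hq.le
  have h2 : 2 * (ε / 2) ≤ (e * eta F n K) / 4 := by linarith
  have hD := hasFDerivAt_Dfix_zero hin hC₂ hb hε₃ h18 h2
  rw [hHcH] at hD
  -- `χ = id − H ∘ Dfix`, derivative `id − Hc ∘ 0 = id`
  have h1 : HasFDerivAt (fun A : PBond (F.P K) 0 → Matrix (Fin 2) (Fin 2) ℂ => Hc (Dfix (CmapTwS F n K h U₀) H C₂ A))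
      (Hc.comp (0 : (PBond (F.P K) 0 → Matrix (Fin 2) (Fin 2) ℂ) →L[ℂ] (PBond (F.P n) 0 → Matrix (Fin 2) (Fin 2) ℂ))) 0 := Hc.hasFDerivAt.comp 0 hD
  have h2' := (hasFDerivAt_id (𝕜 := ℂ) (0 : PBond (F.P K) 0 → Matrix (Fin 2) (Fin 2) ℂ)).sub h1
  rw [ContinuousLinearMap.comp_zero, sub_zero] at h2'
  have hfun : (fun A : PBond (F.P K) 0 → Matrix (Fin 2) (Fin 2) ℂ => A - H (Dfix (CmapTwS F n K h U₀) H C₂ A))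
      = fun A => id A - Hc (Dfix (CmapTwS F n K h U₀) H C₂ A) := by
    funext A; rw [id, LinearMap.coe_toContinuousLinearMap']
  rw [hfun]
  exact h2'

omit [Fact (0 < ((F.L : ℝ)⁻¹) ^ (K - n))] in
/-- `χ(0) = 0` at the member (✓`Dfix_zero` through ✓`inputs_CmapTwS`). [cite: Balaban1985Variational, (47) p.285, (55) p.286] -/
theorem chartTwS_zero {ε₀ e b ε : ℝ} (hε₀ : 0 < ε₀) (he : 0 < e) (hWe : 10 ^ 9 * (F.L : ℝ) ^ 2 * e ≤ 1) (hWε : 10 ^ 12 * (F.L : ℝ) ^ 3 * ε₀ ≤ 1)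
    (U₀ : GaugeField (F.P K) 0 (Matrix.specialUnitaryGroup (Fin 2) ℂ)) (hreg : RegPr F n K ε₀ U₀)
    {H : (PBond (F.P n) 0 → Matrix (Fin 2) (Fin 2) ℂ) →ₗ[ℂ] (PBond (F.P K) 0 → Matrix (Fin 2) (Fin 2) ℂ)} (hb : 0 ≤ b) (hHop : ∀ Y, ‖H Y‖ ≤ b * ‖Y‖)
    (hε : 0 < ε) (hq : 9 * (40 * (2 * (3 * (2 * e + 2700 * (F.L : ℝ) * ε₀))) / (e * eta F n K) ^ 2) * b * ε < 1) (hRε : 6 * ε ≤ e * eta F n K) :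
    (0 : PBond (F.P K) 0 → Matrix (Fin 2) (Fin 2) ℂ) - H (Dfix (CmapTwS F n K h U₀) H (40 * (2 * (3 * (2 * e + 2700 * (F.L : ℝ) * ε₀))) / (e * eta F n K) ^ 2) 0) = 0 := by
  haveI : CompleteSpace (PBond (F.P n) 0 → Matrix (Fin 2) (Fin 2) ℂ) := FiniteDimensional.complete ℂ _
  haveI : CompleteSpace (PBond (F.P K) 0 → Matrix (Fin 2) (Fin 2) ℂ) := FiniteDimensional.complete ℂ _
  set C₂ : ℝ := 40 * (2 * (3 * (2 * e + 2700 * (F.L : ℝ) * ε₀))) / (e * eta F n K) ^ 2 with hC₂def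
  have hη : 0 < eta F n K := eta_pos F n K
  have hC₂ : 0 ≤ C₂ := by
    have hL : (0 : ℝ) < (F.L : ℝ) := Fact.out
    positivity
  set Hc : (PBond (F.P n) 0 → Matrix (Fin 2) (Fin 2) ℂ) →L[ℂ] (PBond (F.P K) 0 → Matrix (Fin 2) (Fin 2) ℂ) := LinearMap.toContinuousLinearMap H with hHc
  have hHcH : (Hc : (PBond (F.P n) 0 → Matrix (Fin 2) (Fin 2) ℂ) →ₗ[ℂ] (PBond (F.P K) 0 → Matrix (Fin 2) (Fin 2) ℂ)) = H := LinearMap.coe_toContinuousLinearMap H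
  have hin : B11Prop3Model.Inputs (CmapTwS F n K h U₀) (Hc : (PBond (F.P n) 0 → Matrix (Fin 2) (Fin 2) ℂ) →ₗ[ℂ] (PBond (F.P K) 0 → Matrix (Fin 2) (Fin 2) ℂ))
      C₂ C₂ b ((e * eta F n K) / 4) := by
    rw [hHcH]; exact inputs_CmapTwS F h hε₀ he hWe hWε U₀ hreg hHop
  have hε₃ : 0 < ε / 2 := by linarith
  have h18 : 18 * C₂ * b * (ε / 2) ≤ 1 := by
    have : 18 * C₂ * b * (ε / 2) = 9 * C₂ * b * ε := by ring
    rw [this]; exact hq.le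
  have h2 : 2 * (ε / 2) ≤ (e * eta F n K) / 4 := by linarith
  have hD0 := Dfix_zero hin hC₂ hb hε₃ h18 h2
  rw [hHcH] at hD0
  rw [hD0, map_zero, sub_zero]

/-! ## §3 The door's `hSplit127` at `A′ = 0` -/

/-- ★★ **`hSplit127` AT THE BASE POINT, FROM `RegPr U₀` ALONE.**  The displayed hypothesis of ✓`Prop7Crit127OfCrit93Split.hCrit127_of_hCrit93_of_split127` read at `A′ := 0`, `X := 0`,
`Ker δ := (QTwS U₀ δ = 0)`, `Sl := IsLandauPrintS c₀ cB U₀` — VERBATIM: for every continuous linear `D` with `HasFDerivAt χ D 0` and every skew-Hermitian-traceless `δ` with `QTwS U₀ δ = 0`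
there are a skew-Hermitian-traceless `δ_L` with `QTwS U₀ δ_L = 0`, `IsLandauPrintS c₀ cB U₀ δ_L` and a Hermitian-traceless site field `N` with `g(ad(−χ(0)(b)))((Dδ)(b)) = g(ad(−χ(0)(b)))((Dδ_L)(b))
+ (iN(b₋) − U′(b)·iN(b₊)·U′(b)^*)`, `U′ = emb15 U₀ (expHermField 0)`.  Proof: `D = id` (§2 + uniqueness of the Fréchet derivative), `χ(0) = 0`, `g(ad 0) = 1`, `expHermField 0 = 1`, and the
split is ✓`exists_slice_add_gaugeDir_hsplit_at_regPr` ([Balaban1985RegularSpaces] Sect. D linearised at `U₀`). [cite: Balaban1985Variational, (123)-(127) pp.296-297, (47)-(55) pp.285-286; Balaban1985RegularSpaces, Sect. D pp.89-95; Balaban1985Averaging, (29), (33) p.22] -/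
theorem split127_at_zero {c₀ cB : ℝ} [Fact (0 < c₀)] [Fact (0 < cB)]
    {ε₀ e b ε : ℝ} (hε₀ : 0 < ε₀) (he : 0 < e) (hWe : 10 ^ 9 * (F.L : ℝ) ^ 2 * e ≤ 1) (hWε : 10 ^ 12 * (F.L : ℝ) ^ 3 * ε₀ ≤ 1)
    (U₀ : GaugeField (F.P K) 0 (Matrix.specialUnitaryGroup (Fin 2) ℂ)) (hreg : RegPr F n K ε₀ U₀)
    {H : (PBond (F.P n) 0 → Matrix (Fin 2) (Fin 2) ℂ) →ₗ[ℂ] (PBond (F.P K) 0 → Matrix (Fin 2) (Fin 2) ℂ)} (hb : 0 ≤ b) (hHop : ∀ Y, ‖H Y‖ ≤ b * ‖Y‖)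
    (hε : 0 < ε) (hq : 9 * (40 * (2 * (3 * (2 * e + 2700 * (F.L : ℝ) * ε₀))) / (e * eta F n K) ^ 2) * b * ε < 1) (hRε : 6 * ε ≤ e * eta F n K) :
    ∀ D : (PBond (F.P K) 0 → Matrix (Fin 2) (Fin 2) ℂ) →L[ℂ] (PBond (F.P K) 0 → Matrix (Fin 2) (Fin 2) ℂ),
      HasFDerivAt (fun A : PBond (F.P K) 0 → Matrix (Fin 2) (Fin 2) ℂ =>
        A - H (Dfix (CmapTwS F n K h U₀) H (40 * (2 * (3 * (2 * e + 2700 * (F.L : ℝ) * ε₀))) / (e * eta F n K) ^ 2) A)) D 0 →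
      ∀ δ : PBond (F.P K) 0 → Matrix (Fin 2) (Fin 2) ℂ, (∀ b', star (δ b') = -δ b' ∧ (δ b').trace = 0) → QTwS F n K h U₀ δ = 0 →
      ∃ δL : PBond (F.P K) 0 → Matrix (Fin 2) (Fin 2) ℂ, (∀ b', star (δL b') = -δL b' ∧ (δL b').trace = 0) ∧ QTwS F n K h U₀ δL = 0 ∧
        IsLandauPrintS F n K h c₀ cB U₀ δL ∧
        ∃ N : Site (F.P K) 0 → Matrix (Fin 2) (Fin 2) ℂ, (∀ x, (N x).IsHermitian ∧ (N x).trace = 0) ∧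
          ∀ b' : PBond (F.P K) 0,
            gSer ℂ (ad ℂ (-((0 : PBond (F.P K) 0 → Matrix (Fin 2) (Fin 2) ℂ) - H (Dfix (CmapTwS F n K h U₀) H (40 * (2 * (3 * (2 * e + 2700 * (F.L : ℝ) * ε₀))) / (e * eta F n K) ^ 2) 0)) b')) ((D δ) b')
              = gSer ℂ (ad ℂ (-((0 : PBond (F.P K) 0 → Matrix (Fin 2) (Fin 2) ℂ) - H (Dfix (CmapTwS F n K h U₀) H (40 * (2 * (3 * (2 * e + 2700 * (F.L : ℝ) * ε₀))) / (e * eta F n K) ^ 2) 0)) b')) ((D δL) b')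
                + (Complex.I • N b'.src - ((emb15 U₀ (expHermField (fun _ : PBond (F.P K) 0 => (0 : Matrix (Fin 2) (Fin 2) ℂ))) b' : Matrix.specialUnitaryGroup (Fin 2) ℂ) : Matrix (Fin 2) (Fin 2) ℂ) * (Complex.I • N b'.tgt)
                    * star ((emb15 U₀ (expHermField (fun _ : PBond (F.P K) 0 => (0 : Matrix (Fin 2) (Fin 2) ℂ))) b' : Matrix.specialUnitaryGroup (Fin 2) ℂ) : Matrix (Fin 2) (Fin 2) ℂ)) := by
  intro D hD δ hδR hδQ
  -- `D = id`
  have hid := hasFDerivAt_chartTwS_zero F h hε₀ he hWe hWε U₀ hreg hb hHop hε hq hRε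
  have hDid : D = ContinuousLinearMap.id ℂ (PBond (F.P K) 0 → Matrix (Fin 2) (Fin 2) ℂ) := hD.unique hid
  -- `χ(0) = 0`, `U′ = U₀`
  have hχ0 := chartTwS_zero F h hε₀ he hWe hWε U₀ hreg hb hHop hε hq hRε
  have hU' : emb15 U₀ (expHermField (fun _ : PBond (F.P K) 0 => (0 : Matrix (Fin 2) (Fin 2) ℂ))) = U₀ := by
    rw [expHermField_zero]
    funext b
    show (1 : GaugeField (F.P K) 0 (Matrix.specialUnitaryGroup (Fin 2) ℂ)) b * U₀ b = U₀ b
    exact one_mul (U₀ b)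
  -- the split at `U₀`
  obtain ⟨τ, N, hτR, hN, hτQ, hτL, -, hdec⟩ := exists_slice_add_gaugeDir_hsplit_at_regPr (h := h) (c₀ := c₀) (cB := cB) hε₀ he hWe hWε U₀ hreg δ hδR hδQ
  refine ⟨τ, hτR, hτQ, hτL, N, hN, fun b' => ?_⟩
  rw [hχ0, hDid, hU']
  simp only [Pi.zero_apply, neg_zero, ContinuousLinearMap.id_apply]
  have had : ad ℂ (0 : Matrix (Fin 2) (Fin 2) ℂ) = 0 := by
    ext1 v; simp
  rw [had, gSer_zero]
  exact hdec b'

end Member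

end Summit.QuantumFields.YangMills.Theorems.Prop7Crit127Split127AtZero

end
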